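import Summits.ResolutionOfSingularities.ResolutionOfSingularities.Theorems.EquisingularLiftEquisingularLiftNatDirectionChartData
import Mathlib.LinearAlgebra.Matrix.NonsingularInverse
import HarnessLib

/-!
# [OURS · L1 W4.5(b) · EL♮(3)] T-DIRLIFT-UP (L), brick C2, bridge piece Σ3 — the exact ring relation between two DICT-adapted frames on a
# common affine

Crux chain w45b (cell `res-hironaka`, slot W4.5(b)), child crux **EL♮(3)** = stmt-ResolutionOfSingularities-20148, route EquisingularLift; object (L),
brick C2, bridge piece **Σ3** of res-type-027 g15's (★) assembly `cechPic_pullback_detClass_conormal_section` (signature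
`L/res-type-027/Bridge-pieces2.sig.lean` 5762fafcbd00006d, first declaration, VERBATIM). Written by res-L1-w45b-stub-4 g9. HONEST FRAMING: OURS; NOT a
statement of any manuscript; AI-written, weaker than expert review. No `sorry`; standard axioms; DEF-FREE.
`--supports stmt-ResolutionOfSingularities-20148 --as helper`.

WHAT (`adaptedFrame_rel_of_dict`). Two DICT-adapted frames `c^p = A^p · (x^p|_{W_p})`, `c^q = A^q · (x^q|_{W_q})` of the trace ideal on the
special fibre (`A^p` invertible), with `x^q| = N x^p|` on an `X₀`-affine `V″` below both charts (res-D-pv-051's `exists_changeOfGenerators`): on any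
affine `W″ ⊆ W_p ∩ W_q ∩ j₀⁻¹V″`, `c^q|_{W″} = (A^q| · (j₀♯N) · (A^p|)⁻¹) *ᵥ c^p|_{W″}` — pure matrix algebra (`Matrix.nonsing_inv_mul`,
`Matrix.mulVec_mulVec`, `RingHom.map_det`).

References (method): H. Matsumura, *Commutative Ring Theory* (1986), §16 (index only).
-/

set_option linter.dupNamespace false -- mandated namespace `Summit.<Summit>.<Problem>` of this single-conjunct summit

noncomputable section

open CategoryTheory AlgebraicGeometry Opposite TopologicalSpace
open Literature.AlgebraicGeometry.Modules
open AlgebraicGeometry.Scheme.IdealSheafData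
open scoped Matrix

namespace Summit.ResolutionOfSingularities.ResolutionOfSingularities.Cruxes.EquisingularLiftNat.Sections

open Summit.ResolutionOfSingularities.ResolutionOfSingularities.Cruxes.EquisingularLiftNat.P1VB

/-- **Σ3 — the exact ring relation between two DICT-adapted frames on a common affine.** See the module docstring.
[cite: Matsumura1987, §16 (index only)] [OURS · L1 W4.5b · C2 bridge piece Σ3; signature res-type-027 VERBATIM] toward
`stub_elnat_three_liftSections` (stmt-ResolutionOfSingularities-20148); NOT a statement of the manuscript. -/
theorem adaptedFrame_rel_of_dict {X₀ G₀ : Scheme.{0}} (j₀ : G₀ ⟶ X₀)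
    (Vp Vq V'' : X₀.affineOpens) (hVp : (V'' : X₀.Opens) ≤ Vp) (hVq : (V'' : X₀.Opens) ≤ Vq)
    (xp : Fin 2 → Γ(X₀, (Vp : X₀.Opens))) (xq : Fin 2 → Γ(X₀, (Vq : X₀.Opens)))
    (N : Matrix (Fin 2) (Fin 2) Γ(X₀, (V'' : X₀.Opens)))
    (hN : ∀ j, X₀.presheaf.map (homOfLE hVq).op (xq j) = ∑ l, N j l * X₀.presheaf.map (homOfLE hVp).op (xp l))
    (Wp Wq W'' : G₀.affineOpens) (hWVp : (Wp : G₀.Opens) ≤ j₀ ⁻¹ᵁ (Vp : X₀.Opens)) (hWVq : (Wq : G₀.Opens) ≤ j₀ ⁻¹ᵁ (Vq : X₀.Opens))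
    (hp'' : (W'' : G₀.Opens) ≤ Wp) (hq'' : (W'' : G₀.Opens) ≤ Wq) (hWV'' : (W'' : G₀.Opens) ≤ j₀ ⁻¹ᵁ (V'' : X₀.Opens))
    (Ap : Matrix (Fin 2) (Fin 2) Γ(G₀, (Wp : G₀.Opens))) (Aq : Matrix (Fin 2) (Fin 2) Γ(G₀, (Wq : G₀.Opens))) (hAp : IsUnit Ap.det)
    (cp : Fin 2 → Γ(G₀, (Wp : G₀.Opens))) (cq : Fin 2 → Γ(G₀, (Wq : G₀.Opens)))
    (hcp : ∀ i, cp i = ∑ j, Ap i j * j₀.appLE (Vp : X₀.Opens) (Wp : G₀.Opens) hWVp (xp j))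
    (hcq : ∀ i, cq i = ∑ j, Aq i j * j₀.appLE (Vq : X₀.Opens) (Wq : G₀.Opens) hWVq (xq j)) (i : Fin 2) :
    G₀.presheaf.map (homOfLE hq'').op (cq i) =
      ∑ r, (Aq.map (G₀.presheaf.map (homOfLE hq'').op).hom * N.map (j₀.appLE (V'' : X₀.Opens) (W'' : G₀.Opens) hWV'').hom *
          (Ap.map (G₀.presheaf.map (homOfLE hp'').op).hom)⁻¹) i r * G₀.presheaf.map (homOfLE hp'').op (cp r) := by
  classical
  -- restriction maps and the restricted data on `W''`
  let ρp : Γ(G₀, (Wp : G₀.Opens)) →+* Γ(G₀, (W'' : G₀.Opens)) := (G₀.presheaf.map (homOfLE hp'').op).hom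
  let ρq : Γ(G₀, (Wq : G₀.Opens)) →+* Γ(G₀, (W'' : G₀.Opens)) := (G₀.presheaf.map (homOfLE hq'').op).hom
  let φ : Γ(X₀, (V'' : X₀.Opens)) →+* Γ(G₀, (W'' : G₀.Opens)) := (j₀.appLE (V'' : X₀.Opens) (W'' : G₀.Opens) hWV'').hom
  let xpW : Fin 2 → Γ(G₀, (W'' : G₀.Opens)) := fun l => j₀.appLE (Vp : X₀.Opens) (W'' : G₀.Opens) (hp''.trans hWVp) (xp l)
  let xqW : Fin 2 → Γ(G₀, (W'' : G₀.Opens)) := fun l => j₀.appLE (Vq : X₀.Opens) (W'' : G₀.Opens) (hq''.trans hWVq) (xq l)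
  let ApW : Matrix (Fin 2) (Fin 2) Γ(G₀, (W'' : G₀.Opens)) := Ap.map ρp
  let AqW : Matrix (Fin 2) (Fin 2) Γ(G₀, (W'' : G₀.Opens)) := Aq.map ρq
  let NW : Matrix (Fin 2) (Fin 2) Γ(G₀, (W'' : G₀.Opens)) := N.map φ
  -- restriction identities
  have e_xp : ∀ l, ρp (j₀.appLE (Vp : X₀.Opens) (Wp : G₀.Opens) hWVp (xp l)) = xpW l := fun l =>
    secRes_appLE j₀ (Vp : X₀.Opens) hp'' hWVp (xp l)
  have e_xq' : ∀ l, ρq (j₀.appLE (Vq : X₀.Opens) (Wq : G₀.Opens) hWVq (xq l)) = xqW l := fun l =>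
    secRes_appLE j₀ (Vq : X₀.Opens) hq'' hWVq (xq l)
  have a_xq : ∀ j, xqW j = φ (X₀.presheaf.map (homOfLE hVq).op (xq j)) := fun j => by
    change j₀.appLE (Vq : X₀.Opens) (W'' : G₀.Opens) (hq''.trans hWVq) (xq j) =
      (X₀.presheaf.map (homOfLE hVq).op ≫ j₀.appLE (V'' : X₀.Opens) (W'' : G₀.Opens) hWV'') (xq j)
    rw [Scheme.Hom.map_appLE]
  have a_xp : ∀ l, xpW l = φ (X₀.presheaf.map (homOfLE hVp).op (xp l)) := fun l => by
    change j₀.appLE (Vp : X₀.Opens) (W'' : G₀.Opens) (hp''.trans hWVp) (xp l) =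
      (X₀.presheaf.map (homOfLE hVp).op ≫ j₀.appLE (V'' : X₀.Opens) (W'' : G₀.Opens) hWV'') (xp l)
    rw [Scheme.Hom.map_appLE]
  -- (1) `c^p| = A^p| *ᵥ x^p|`, (2) `c^q| = A^q| *ᵥ x^q|`, (3) `x^q| = (j₀♯N) *ᵥ x^p|`
  have H1 : (fun r => ρp (cp r)) = ApW *ᵥ xpW := by
    funext r
    rw [hcp r, map_sum]
    change ∑ j, ρp (Ap r j * _) = ∑ j, ApW r j * xpW j
    refine Finset.sum_congr rfl fun j _ => ?_
    rw [map_mul, e_xp]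
    rfl
  have H2 : (fun r => ρq (cq r)) = AqW *ᵥ xqW := by
    funext r
    rw [hcq r, map_sum]
    change ∑ j, ρq (Aq r j * _) = ∑ j, AqW r j * xqW j
    refine Finset.sum_congr rfl fun j _ => ?_
    rw [map_mul, e_xq']
    rfl
  have H3 : xqW = NW *ᵥ xpW := by
    funext j
    rw [a_xq, hN j, map_sum]
    change ∑ l, φ (N j l * _) = ∑ l, NW j l * xpW l
    refine Finset.sum_congr rfl fun l _ => ?_
    rw [map_mul, ← a_xp]
    rfl
  -- (4) `x^p| = (A^p|)⁻¹ *ᵥ c^p|`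
  have hdet : IsUnit ApW.det := by
    have h := hAp.map ρp
    rw [RingHom.map_det] at h
    exact h
  have H4 : xpW = ApW⁻¹ *ᵥ fun r => ρp (cp r) := by
    rw [H1, Matrix.mulVec_mulVec, Matrix.nonsing_inv_mul _ hdet, Matrix.one_mulVec]
  -- combine
  have H : (fun r => ρq (cq r)) = (AqW * NW * ApW⁻¹) *ᵥ fun r => ρp (cp r) := by
    rw [H2, H3, H4, Matrix.mulVec_mulVec, Matrix.mulVec_mulVec]
  have Hi := congrFun H i
  change ρq (cq i) = ∑ r, (AqW * NW * ApW⁻¹) i r * ρp (cp r)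
  rw [Hi]
  rfl

end Summit.ResolutionOfSingularities.ResolutionOfSingularities.Cruxes.EquisingularLiftNat.Sections

end
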